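import Literature.Geometry.Kaehler.ComplexTorusLatticeSpInvariantPrimitivePolarizationsClassification
import HarnessLib

/-!
# Restricting the invariant polarisations of `Hᵏ(X, ℚ)` to `Hᵏ(X, ℚ)_prim`: `Q_a|_prim = a₀ · Q'` — the two
# classifications (g27-#1 for `Hᵏ`, g28-#6 for `Hᵏ_prim`) are compatible, and every invariant polarisation of the
# primitive part extends to one of `Hᵏ(X, ℚ)`

Layer `Literature/Geometry/Kaehler`, namespace `Literature.Geometry.Kaehler.ComplexTorus`; lane `lit-hodgefound`
(Track 2 foundations library), seat p09, generation 28, row g28-#9. THEOREMS ONLY (no definition, no named fact,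
net debt 0).

For a polarised complex torus `X = E/Φ(ℤ^ι)` of dimension `g` with Riemann form `η`, `k + s = g`, `n ≥ 1`: g27-#1
(`ComplexTorusLatticeSpInvariantPolarizationsClassification`) classified the `Γ_D(n)`-invariant polarisations of the
`ℚ`-Hodge structure `Hᵏ(X, ℚ)` as the weighted forms `Q_a = Σ_r a_r (-1)^{r+k(k-1)/2} Q(π_{k,r} ·, ·)`,
`a ∈ (ℚ_{>0})^{⌊k/2⌋+1}` (`IsRiemannForm.polarizationOfCoeffs`), and g28-#6
(`ComplexTorusLatticeSpInvariantPrimitivePolarizationsClassification`) those of `Hᵏ(X, ℚ)_prim` as the ray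
`ℚ_{>0} · Q'`, `Q' = (-1)^{k(k-1)/2} Q_k|_prim` (`IsRiemannForm.primitivePolarization`). THIS FILE joins them along the
inclusion morphism `Hᵏ(X, ℚ)_prim ↪ Hᵏ(X, ℚ)` (`IsNSForm.primitiveInclusionHom`) and the Motives layer's pull-back of
polarisations (`Polarization.comap`):

* §1 **`Q_a|_{Hᵏ_prim} = a₀ · Q'`**: the pull-back of `Q_a` along the inclusion is `(primitivePolarization).smul (a 0)` —
  on primitive classes only the weight of the summand `r = 0` survives (`π_{k,0} = id`, `π_{k,r} = 0` there);
* §2 hence the restriction of a `Γ_D(n)`-invariant polarisation `P = Q_a` of `Hᵏ(X, ℚ)` to `Hᵏ(X, ℚ)_prim` is the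
  invariant polarisation with scalar `a₀` — the g28-#6 scalar of `P|_prim` is the first weight of `P`;
* §3 conversely **every `Γ_D(n)`-invariant polarisation of `Hᵏ(X, ℚ)_prim` extends to a `Γ_D(n)`-invariant polarisation
  of `Hᵏ(X, ℚ)`** (`a = (a₀, 1, …, 1)`), so the restriction map from the orthant `(ℚ_{>0})^{⌊k/2⌋+1}` onto the ray
  `ℚ_{>0}` is the first-coordinate projection.

## The sources, verbatim

* C. Voisin, *Hodge Theory and Complex Algebraic Geometry I* (2002), §7.1.2 (held chunk p0134), Def. 7.7 and "a
  sub-Hodge structure of a polarised Hodge structure is polarised by the restricted form" (§7.3.1); §6.3.2 Lemma 6.31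
  ("on each primitive component `Lʳ H^{k-2r}_prim`, `H_k` induces the form `(-1)ʳ H_{k-2r}`", chunk p0128).
* R. Goodman, N. R. Wallach (GTM 255), §3.2.4 Thm. 3.2.14 (chunk p0253); J. Carlson, S. Müller-Stach, C. Peters, §2.3
  Cor. 2.3.5 (chunk p0094); P. Deligne, Hodge II, 2.1.15.

## References

* [cite: VoisinHodgeI2002, §7.1.2 Def. 7.7 (PDF p. 134); §7.3.1; §6.3.2 Lemma 6.31 (PDF p. 128)]
* [cite: GoodmanWallachGTM255, §3.2.4 Thm. 3.2.14 (chunk p0253)]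
* [cite: CarlsonMullerStachPeters2017, §2.3 Cor. 2.3.5 (chunk p0094)]
* [cite: DeligneHodgeII1971, 2.1.15]
* [cite: Margulis1991, Chap. I Prop. (3.2.11)]
-/

noncomputable section

open Module Complex
open scoped TensorProduct
open Literature.AlgebraicGeometry.Motives Literature.AlgebraicGeometry.Motives.HodgeStructure

namespace Literature.Geometry.Kaehler.ComplexTorus

variable {ι : Type*} [Fintype ι] [DecidableEq ι] {E : Type*} [NormedAddCommGroup E] [NormedSpace ℂ E]
  [FiniteDimensional ℂ E] (Φ : (ι → ℝ) ≃L[ℝ] E) {η : E [⋀^Fin 2]→L[ℝ] ℝ}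

/-! ## §1 `Q_a|_prim = a₀ · Q'` -/

/-- **The values of `Q_a` on primitive classes: `Q_a(γ, δ) = a₀ (-1)^{k(k-1)/2} Q_k(γ, δ)` for `γ, δ ∈ Hᵏ(X, ℚ)_prim`**
(`k + s = g`): `π_{k,0} γ = γ` and `π_{k,r} γ = 0` for `r ≠ 0` — "on the primitive component, the form is `Q`" (the
`r = 0` case of Lemma 6.31). [cite: VoisinHodgeI2002, §6.3.2 Lemma 6.31 (PDF p. 128); §7.1.2 (PDF p. 134)]
[cite: CarlsonMullerStachPeters2017, §2.3 Cor. 2.3.5 (chunk p0094)] -/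
theorem IsRiemannForm.coe_polarizationOfCoeffs_form_of_mem_primitive (hη : IsRiemannForm Φ η) {g : ℕ}
    (e : Fin (2 * g) ≃ ι) {k s : ℕ} (hk : k + s = g) (a : Fin (k / 2 + 1) → ℚ) (ha : ∀ r, 0 < a r)
    (γ δ : primitiveRationalForms Φ η k) :
    (((hη.polarizationOfCoeffs Φ e hk a ha).form ⟨γ, primitiveRationalForms_le Φ η k γ.2⟩
        ⟨δ, primitiveRationalForms_le Φ η k δ.2⟩ : ℚ) : ℂ) =
      (a 0 : ℂ) * (-1) ^ (k * (k - 1) / 2) *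
        lefschetzIntersectionForm Φ η e hk (γ : E [⋀^Fin k]→L[ℝ] ℂ) (δ : E [⋀^Fin k]→L[ℝ] ℂ) := by
  have hg : finrank ℂ E = g := finrank_eq_of_finTwoMulEquiv Φ e
  have hnd := nondegenerate_of_pos hη.2.2
  have hγ : (γ : E [⋀^Fin k]→L[ℝ] ℂ) ∈ lefschetzSummandForms η k 0 := by
    rw [lefschetzSummandForms_zero]
    exact (mem_primitiveRationalForms_iff.1 γ.2).2
  rw [hη.coe_polarizationOfCoeffs_form_eq_sum Φ e hk a ha, Fintype.sum_eq_single (0 : Fin (k / 2 + 1)) fun r hr ↦ by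
    rw [Submodule.coe_mk, primitiveProj_apply_of_mem_of_ne hnd (by omega) (fun h ↦ hr (Fin.ext h)) hγ, map_zero,
      LinearMap.zero_apply, mul_zero]]
  rw [Submodule.coe_mk, Submodule.coe_mk, Fin.val_zero, zero_add, primitiveProj_apply_of_mem hnd (by omega) hγ]

/-- **`Q_a|_{Hᵏ(X, ℚ)_prim} = a₀ · Q'`**: the pull-back of the weighted polarisation `Q_a` of `Hᵏ(X, ℚ)` along the
inclusion morphism `Hᵏ(X, ℚ)_prim ↪ Hᵏ(X, ℚ)` of `ℚ`-Hodge structures is the positive multiple `a₀ · Q'` of Voisin's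
polarisation of the primitive part ("a sub-Hodge structure of a polarised Hodge structure is polarised by the
restricted form"). [cite: VoisinHodgeI2002, §7.1.2 Def. 7.7 (PDF p. 134); §7.3.1] [cite: CarlsonMullerStachPeters2017, §2.3 Cor. 2.3.5 (chunk p0094)] -/
theorem IsRiemannForm.polarizationOfCoeffs_comap_primitiveInclusionHom (hη : IsRiemannForm Φ η) {g : ℕ}
    (e : Fin (2 * g) ≃ ι) {k s : ℕ} (hk : k + s = g) (a : Fin (k / 2 + 1) → ℚ) (ha : ∀ r, 0 < a r) :
    (hη.polarizationOfCoeffs Φ e hk a ha).comap ((hη.isNSForm Φ).primitiveInclusionHom Φ k)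
        ((hη.isNSForm Φ).primitiveInclusionHom_injective Φ k) =
      (hη.primitivePolarization Φ e hk).smul (a 0) (ha 0) := by
  refine Polarization.ext_of_form_eq (LinearMap.ext₂ fun γ δ ↦ ?_)
  rw [Polarization.comap_form_apply, Polarization.smul_form_apply, IsNSForm.primitiveInclusionHom_toLinearMap]
  apply Rat.cast_injective (α := ℂ)
  change (((hη.polarizationOfCoeffs Φ e hk a ha).form ⟨γ, primitiveRationalForms_le Φ η k γ.2⟩
      ⟨δ, primitiveRationalForms_le Φ η k δ.2⟩ : ℚ) : ℂ) =
    ((a 0 * (hη.isNSForm Φ).primitivePolarizationForm Φ e hk γ δ : ℚ) : ℂ)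
  rw [hη.coe_polarizationOfCoeffs_form_of_mem_primitive Φ e hk a ha, Rat.cast_mul,
    (hη.isNSForm Φ).coe_primitivePolarizationForm Φ e hk, mul_assoc]

/-! ## §2 The restriction of an invariant polarisation of `Hᵏ(X, ℚ)` -/

/-- **The restriction to `Hᵏ(X, ℚ)_prim` of a `Γ_D(n)`-invariant polarisation `P` of `Hᵏ(X, ℚ)` is `a₀ · Q'`, `a₀` the
first weight of `P = Q_a`** (g27-#1 ∘ §1) — the g28-#6 scalar of `P|_prim` is the weight of the primitive summand.
[cite: GoodmanWallachGTM255, §3.2.4 Thm. 3.2.14 (chunk p0253)] [cite: VoisinHodgeI2002, §7.1.2 Def. 7.7 (PDF p. 134)]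
[cite: Margulis1991, Chap. I Prop. (3.2.11)] -/
theorem IsRiemannForm.exists_comap_primitiveInclusionHom_eq_smul_of_levelSp_invariant (hη : IsRiemannForm Φ η)
    {g : ℕ} (e : Fin (2 * g) ≃ ι) {k s : ℕ} (hk : k + s = g) (n : ℕ) [NeZero n]
    (P : (hodgeStructure Φ k).Polarization)
    (hP : ∀ (T : E →L[ℝ] E) (hT : ∀ u v : E, η ![T u, T v] = η ![u, v])
      (hTΛ : ∀ m : ι → ℤ, ∃ m' : ι → ℤ, T (latticeVec Φ m) = latticeVec Φ (m + (n : ℤ) • m'))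
      (γ δ : rationalForms Φ k),
      P.form ⟨(γ : E [⋀^Fin k]→L[ℝ] ℂ).compContinuousLinearMap T,
          compContinuousLinearMap_mem_rationalForms_of_levelSp γ.2 hTΛ⟩
        ⟨(δ : E [⋀^Fin k]→L[ℝ] ℂ).compContinuousLinearMap T,
          compContinuousLinearMap_mem_rationalForms_of_levelSp δ.2 hTΛ⟩ = P.form γ δ) :
    ∃ (a : Fin (k / 2 + 1) → ℚ) (ha : ∀ r, 0 < a r), P = hη.polarizationOfCoeffs Φ e hk a ha ∧
      P.comap ((hη.isNSForm Φ).primitiveInclusionHom Φ k) ((hη.isNSForm Φ).primitiveInclusionHom_injective Φ k) =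
        (hη.primitivePolarization Φ e hk).smul (a 0) (ha 0) := by
  obtain ⟨a, ha, rfl⟩ := (hη.levelSp_invariant_iff_exists_eq_polarizationOfCoeffs Φ e hk n P).1 hP
  exact ⟨a, ha, rfl, hη.polarizationOfCoeffs_comap_primitiveInclusionHom Φ e hk a ha⟩

/-- **The restriction of a `Γ_D(n)`-invariant polarisation of `Hᵏ(X, ℚ)` is a `Γ_D(n)`-invariant polarisation of
`Hᵏ(X, ℚ)_prim`** (indeed a positive multiple of `Q'`, which is `Sp(E, η)`-invariant).
[cite: VoisinHodgeI2002, §7.1.2 Def. 7.7 (PDF p. 134)] [cite: GoodmanWallachGTM255, §3.2.4 Thm. 3.2.14 (chunk p0253)] -/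
theorem IsRiemannForm.comap_primitiveInclusionHom_levelSp_invariant (hη : IsRiemannForm Φ η) {g : ℕ}
    (e : Fin (2 * g) ≃ ι) {k s : ℕ} (hk : k + s = g) (n : ℕ) [NeZero n] (P : (hodgeStructure Φ k).Polarization)
    (hP : ∀ (T : E →L[ℝ] E) (hT : ∀ u v : E, η ![T u, T v] = η ![u, v])
      (hTΛ : ∀ m : ι → ℤ, ∃ m' : ι → ℤ, T (latticeVec Φ m) = latticeVec Φ (m + (n : ℤ) • m'))
      (γ δ : rationalForms Φ k),
      P.form ⟨(γ : E [⋀^Fin k]→L[ℝ] ℂ).compContinuousLinearMap T,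
          compContinuousLinearMap_mem_rationalForms_of_levelSp γ.2 hTΛ⟩
        ⟨(δ : E [⋀^Fin k]→L[ℝ] ℂ).compContinuousLinearMap T,
          compContinuousLinearMap_mem_rationalForms_of_levelSp δ.2 hTΛ⟩ = P.form γ δ)
    (T : E →L[ℝ] E) (hT : ∀ u v : E, η ![T u, T v] = η ![u, v])
    (hTΛ : ∀ m : ι → ℤ, ∃ m' : ι → ℤ, T (latticeVec Φ m) = latticeVec Φ (m + (n : ℤ) • m'))
    (γ δ : primitiveRationalForms Φ η k) :
    (P.comap ((hη.isNSForm Φ).primitiveInclusionHom Φ k) ((hη.isNSForm Φ).primitiveInclusionHom_injective Φ k)).form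
        ⟨(γ : E [⋀^Fin k]→L[ℝ] ℂ).compContinuousLinearMap T,
          compContinuousLinearMap_mem_primitiveRationalForms_of_levelSp γ.2 hT hTΛ⟩
        ⟨(δ : E [⋀^Fin k]→L[ℝ] ℂ).compContinuousLinearMap T,
          compContinuousLinearMap_mem_primitiveRationalForms_of_levelSp δ.2 hT hTΛ⟩ =
      (P.comap ((hη.isNSForm Φ).primitiveInclusionHom Φ k) ((hη.isNSForm Φ).primitiveInclusionHom_injective Φ k)).form
        γ δ := by
  obtain ⟨a, ha, -, hcomap⟩ := hη.exists_comap_primitiveInclusionHom_eq_smul_of_levelSp_invariant Φ e hk n P hP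
  rw [hcomap]
  exact hη.primitivePolarization_smul_form_levelSp_invariant Φ e hk (ha 0) T hT hTΛ γ δ

/-! ## §3 Every invariant polarisation of `Hᵏ(X, ℚ)_prim` extends to `Hᵏ(X, ℚ)` -/

/-- **Every `Γ_D(n)`-invariant polarisation of `Hᵏ(X, ℚ)_prim` is the restriction of a `Γ_D(n)`-invariant polarisation
of `Hᵏ(X, ℚ)`**: `P' = a₀ · Q'` (g28-#6) is the restriction of `Q_a` with `a = (a₀, 1, …, 1)` (§1), and `Q_a` is
invariant (g26-#14). [cite: VoisinHodgeI2002, §7.1.2 Def. 7.7 (PDF p. 134)] [cite: GoodmanWallachGTM255, §3.2.4 Thm. 3.2.14 (chunk p0253)]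
[cite: CarlsonMullerStachPeters2017, §2.3 Cor. 2.3.5 (chunk p0094)] -/
theorem IsRiemannForm.exists_comap_primitiveInclusionHom_eq_of_levelSp_invariant (hη : IsRiemannForm Φ η) {g : ℕ}
    (e : Fin (2 * g) ≃ ι) {k s : ℕ} (hk : k + s = g) (n : ℕ) [NeZero n]
    (P' : ((hη.isNSForm Φ).primitiveHodgeStructure Φ k).Polarization)
    (hP' : ∀ (T : E →L[ℝ] E) (hT : ∀ u v : E, η ![T u, T v] = η ![u, v])
      (hTΛ : ∀ m : ι → ℤ, ∃ m' : ι → ℤ, T (latticeVec Φ m) = latticeVec Φ (m + (n : ℤ) • m'))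
      (γ δ : primitiveRationalForms Φ η k),
      P'.form ⟨(γ : E [⋀^Fin k]→L[ℝ] ℂ).compContinuousLinearMap T,
          compContinuousLinearMap_mem_primitiveRationalForms_of_levelSp γ.2 hT hTΛ⟩
        ⟨(δ : E [⋀^Fin k]→L[ℝ] ℂ).compContinuousLinearMap T,
          compContinuousLinearMap_mem_primitiveRationalForms_of_levelSp δ.2 hT hTΛ⟩ = P'.form γ δ) :
    ∃ (P : (hodgeStructure Φ k).Polarization),
      (∀ (T : E →L[ℝ] E) (hT : ∀ u v : E, η ![T u, T v] = η ![u, v])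
        (hTΛ : ∀ m : ι → ℤ, ∃ m' : ι → ℤ, T (latticeVec Φ m) = latticeVec Φ (m + (n : ℤ) • m'))
        (γ δ : rationalForms Φ k),
        P.form ⟨(γ : E [⋀^Fin k]→L[ℝ] ℂ).compContinuousLinearMap T,
            compContinuousLinearMap_mem_rationalForms_of_levelSp γ.2 hTΛ⟩
          ⟨(δ : E [⋀^Fin k]→L[ℝ] ℂ).compContinuousLinearMap T,
            compContinuousLinearMap_mem_rationalForms_of_levelSp δ.2 hTΛ⟩ = P.form γ δ) ∧
      P.comap ((hη.isNSForm Φ).primitiveInclusionHom Φ k) ((hη.isNSForm Φ).primitiveInclusionHom_injective Φ k) =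
        P' := by
  obtain ⟨a₀, ha₀, rfl⟩ := hη.exists_eq_primitivePolarization_smul_of_levelSp_invariant Φ e hk n P' hP'
  -- the weights `(a₀, 1, …, 1)`
  set a : Fin (k / 2 + 1) → ℚ := fun r ↦ if r = 0 then a₀ else 1 with ha_def
  have ha : ∀ r, 0 < a r := fun r ↦ by
    show 0 < (if r = 0 then a₀ else 1)
    split_ifs
    · exact ha₀
    · exact one_pos
  refine ⟨hη.polarizationOfCoeffs Φ e hk a ha,
    (hη.levelSp_invariant_iff_exists_eq_polarizationOfCoeffs Φ e hk n _).2 ⟨a, ha, rfl⟩, ?_⟩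
  rw [hη.polarizationOfCoeffs_comap_primitiveInclusionHom Φ e hk a ha]
  have h0 : a 0 = a₀ := if_pos rfl
  exact Polarization.ext_of_form_eq (LinearMap.ext₂ fun γ δ ↦ by
    rw [Polarization.smul_form_apply, Polarization.smul_form_apply, h0])

end Literature.Geometry.Kaehler.ComplexTorus
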